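import Literature.MathematicalPhysics.QuantumFieldTheory.Balaban1983to89.B6TwoScaleGeometryV1

/-!
# `Balaban1983to89.B6Prop27PrintedTwoScaleV1` — T. Bałaban, *Propagators and renormalization transformations for lattice gauge theories. II*,
# Commun. Math. Phys. **96** (1984) 223–250 [Balaban1984PropagatorsII], p. 249 **PROPOSITION 2.7 (2.149) — THE VERBATIM CENSUS TYPING
# `…B6.Prop27Printed` INHABITED HYPOTHESIS-FREE ON THE GENUINE TWO-SCALE FAMILY** (two adjacent levels `𝔅 = Λ^c ⊔ Λ′`, `Λ′ ⊂ T^{(j+1)}` ARBITRARY,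
# every volume, every `j`, all weights of the printed window) by the genuine `(QGQ*)⁻¹` of the data `tsV1` at the PRINTED normalisation
# (`c² = η^{d+1}L^{2j}`, `κ = 1`), from gen 17's (2.148) `…B6Ineq2148TwoScaleV1.ineq2148_V1_uniform`

statement-level skeleton of published theorems with citation tags; proofs where landed; nothing here is a claim about the Yang–Mills mass gap

PRINT (verbatim, p. 249, = the docstring of `…B6.Prop27Printed`): *"Proposition 2.7. The operator (QGQ*)⁻¹ is given by the convergent expansions of the form
(2.86), and it satisfies the bound |(QGQ*)⁻¹(b, b′)| ≦ O(1)(L^jη)^{−2}(L^{j′}η)^{−d}e^{−½δ₄d(b,b′)}, b ∈ Λ_j, b′ ∈ Λ_{j′}. (2.149)"* (the census Prop types the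
BOUND; the expansion (2.86) is the printed route, at two levels with one box the global `(QGQ*)⁻¹` IS the box operator `C_□` of (2.143)/(2.148)).

CITATION HEADER (lean-in-tree rule) — WHAT IS REPRODUCED.  Phase-2 file of the `lit-balaban` typed skeleton (HOME `run/shared/lean/pub/lit-balaban/`), seat
**p22 gen 17** (B6 fold owner r03, referee ref-4).  SKELETON row **B6.Prop2.7** (head `proved-existing`: the printed proof at power `p = 2` kernel-checked,
`…B6Prop27Kernel`; model instances: p01's ONE-scale `…B6Prop27OneScaleTorus.prop27Printed_oneScaleTorus`, r03's block family `…B6BlockParamOneLevel`, the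
abstract two-level/tower families `…B6Prop27TwoLevel`/`…B6TowerPrinted`).  THIS FILE = the GENUINE TWO-SCALE member instance on the concrete V1 data
`tsV1`: `B6.Prop27Printed (d + 1)` INHABITED, hypothesis-free, on the family of all frames `(m, K, j, Λ′)` (gen 17's `…B6TwoScaleGeometryV1.twoScaleGeo`)
with weights `a₀ ≤ w ≤ a₁` on `𝔅`, the kernel being the ENTRIES of `Ring.inverse (…B6Eq2143TwoScaleV1.QGQs)` at the printed normalisation
`c₁ = (η^{d+1}L^{2j})^{1/2}` (`κ = c₁²/(η^{d+1}L^{2j}) = 1`, gen 10's `…B6Ineq2118TwoScaleV1.kappa_eq_one`: the normalisation at which (2.147) holds with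
print's `γ₀(d, L)`, `…B6Ineq2147TwoScaleV1B1.ineq2147_V1_printed`).  IMPORTS BY NAME: `…B6Ineq2148TwoScaleV1.ineq2148_V1_uniform` ((2.148) uniformly, any
`c ≠ 0`), `…B6TwoScaleGeometryV1` (the frame, `len` bookkeeping), `…B6` (`Prop27Printed`, `SiteKernel`).

THIS FILE: §1 `Index` (a frame + weights of the printed window), `Index.c₁` (+ `c₁_sq`, `c₁_ne_zero`, `kappa_c₁`), the kernel reading **`Index.qinv`**
(`ker b b′ = ⟨e_b, (QGQ*)⁻¹e_{b′}⟩`); §2 **`prop27Printed_twoScale : B6.Prop27Printed (d + 1) (fun i => twoScaleGeo i.toFrame) (fun i => i.qinv)`** (witnesses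
`M₁ = 1`, `δ₄ := 2δ` with `δ` the rate of `ineq2148_V1_uniform`, `O(1) = A·L²·L^{d+1}` with `A = 2(a₁(1 + L^{−(d+1)}) + 8(d+1)γ₁)(2 + 4L² + L^{d+3})` the
(2.148) prefactor at `κ = 1`) and the non-vacuity `twoScale27_meets_hypotheses`.  DEFINITIONS (data) + THEOREMS; no `def … : Prop` fact; standard axioms.
HONEST SCOPE / DIVERGENCES: two adjacent levels (print: `k + 1`); the bound only (not the expansion (2.86), immaterial at two levels with one box); the
readings of `…B6TwoScaleGeometryV1` (`dist` dominates (2.46); length factors `(L^jη)^{−2}(L^{j′}η)^{−d} ∈ [L^{−(d+3)}, 1]` absorbed into `O(1)`); `O(1)`, `δ₄`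
depend on `d, L` AND the weight window `a₀, a₁` (print: `a` fixed); entries in the orthonormal basis of `L²(𝔅)` at `κ = 1` (print's kernel w.r.t. the
unit-lattice pairing).  NOT summit progress.  Unit `lit-balaban-p22` (gen 17), 2026-08-22.
-/

noncomputable section

open scoped InnerProductSpace
open Finset

namespace Literature.MathematicalPhysics.QuantumFieldTheory.Balaban1983to89.B6Prop27PrintedTwoScaleV1

open LatticeFieldCalculus B6SectAOperatorsV1 B6SectCTwoScaleV1 B6SectCTwoScaleV1Lattice
open B5SectBStatements (eta)
open B4Sect5Torus (IsPseudoDist)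
open B4TorusKernel.MultiPeriod (torusSupNorm)
open B5Eq117TorusCarriers (Mk)
open B6LowerBound2153Torus (rep)
open B6BlockDecayCalculus (torusDist_isPseudoDist)
open B6Eq2143TwoScaleV1 (QGQs)
open B6Ineq2148TwoScaleV1 (ineq2148_V1_uniform)
open B6TwoScaleGeometryV1 (Frame twoScaleGeo len_rpow_neg_ge one_le_rpow_mul_len)
open Beta.Ineq167OperatorUpper (gamma1)

variable (d L : ℕ) (hd : 1 ≤ d + 1) (hL : Odd L ∧ 1 < L) (a₀ a₁ : ℝ)

/-! ## §1  The index, the printed normalisation, the kernel reading -/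

/-- the index of the genuine two-scale family at the PRINTED normalisation: a frame `(m, K, j, Λ′)` and weights `a₀ ≤ w ≤ a₁` on `𝔅 = Λ^c ⊔ Λ′`
(`κ = 1`: [4]'s window `a₀ ≤ a ≤ a₁` as printed). [cite: Balaban1984PropagatorsII, (2.97) p.240, (2.143) p.248] -/
structure Index extends Frame d L hd hL where
  /-- the weights on `𝔅 = Λ^c ⊔ Λ′` -/
  w : CIdx j Λ' → ℝ
  hw0 : ∀ i, a₀ ≤ w i
  hw1 : ∀ i, w i ≤ a₁

variable {d L hd hL a₀ a₁}

namespace Index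

variable (i : Index d L hd hL a₀ a₁)

/-- **the printed normalisation `c₁ = (η^{d+1}L^{2j})^{1/2}`** of the fine-lattice factor (so that `κ = c₁²/(η^{d+1}L^{2j}) = 1`: the (1.21) weight `η^d` and the
`η⁻¹` inside `∂`). [cite: Balaban1984PropagatorsI, (1.21) p.21; Balaban1984PropagatorsII, (2.95) p.240] -/
def c₁ : ℝ := Real.sqrt (eta L i.j ^ (d + 1) * ((L : ℝ) ^ i.j) ^ 2)

/-- `η^{d+1}L^{2j} > 0`. [cite: Balaban1984PropagatorsI, (1.21) p.21] -/
theorem etaL_pos : 0 < eta L i.j ^ (d + 1) * ((L : ℝ) ^ i.j) ^ 2 := by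
  have hL0 : (0 : ℝ) < L := by exact_mod_cast (lt_trans Nat.zero_lt_one hL.2)
  have hη : 0 < eta L i.j := by rw [eta]; positivity
  positivity

/-- `c₁² = η^{d+1}L^{2j}`. [cite: Balaban1984PropagatorsI, (1.21) p.21] -/
theorem c₁_sq : i.c₁ ^ 2 = eta L i.j ^ (d + 1) * ((L : ℝ) ^ i.j) ^ 2 := Real.sq_sqrt i.etaL_pos.le

/-- `c₁ ≠ 0`. [cite: Balaban1984PropagatorsI, (1.21) p.21] -/
theorem c₁_ne_zero : i.c₁ ≠ 0 := Real.sqrt_ne_zero'.mpr i.etaL_pos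

/-- `κ = 1` at the printed normalisation (gen 10's `kappa_eq_one`). [cite: Balaban1984PropagatorsI, (1.21) p.21] -/
theorem kappa_c₁ : i.c₁ ^ 2 / (eta L i.j ^ (d + 1) * ((L : ℝ) ^ i.j) ^ 2) = 1 := by
  rw [c₁_sq]
  exact div_self i.etaL_pos.ne'

/-- **the kernel reading**: `(QGQ*)⁻¹(b, b′) := ⟨e_b, (QGQ*)⁻¹e_{b′}⟩`, the entries of `Ring.inverse (QGQs)` of the member at the printed normalisation
(at two levels with one box, the global `(QGQ*)⁻¹` is the `C_□` of (2.143)). [cite: Balaban1984PropagatorsII, (2.143) p.248, (2.149) p.249] -/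
def qinv [DecidableEq (CIdx i.j i.Λ')] : B6.SiteKernel (twoScaleGeo i.toFrame) where
  ker := fun b b' => ⟪EuclideanSpace.single b (1 : ℝ), Ring.inverse (QGQs i.c₁_ne_zero i.Λ' (w := i.w)) (EuclideanSpace.single b' (1 : ℝ))⟫_ℝ

end Index

/-! ## §2  Proposition 2.7 verbatim on the two-scale family -/

open Classical in
/-- **PROPOSITION 2.7 (2.149), VERBATIM (`B6.Prop27Printed`), ON THE GENUINE TWO-SCALE FAMILY WITH NO HYPOTHESIS**: for every dimension `d + 1`, odd `L > 1`
and printed weight window `0 < a₀ ≤ a₁` the census Prop holds for the family of all two-scale data `tsV1` at the printed normalisation (all volumes, levels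
`j + 1 ≤ m + K`, regions `Λ′ ⊂ T^{(j+1)}`, weights of the window), the kernel being the entries of `(QGQ*)⁻¹` — witnesses `M₁ = 1`, `δ₄ = 2δ` (`δ` the uniform
rate of (2.148)), `O(1) = A·L²·L^{d+1}`. [cite: Balaban1984PropagatorsII, Prop. 2.7 (2.149) p.249] -/
theorem prop27Printed_twoScale (ha₀ : 0 < a₀) (ha₁ : a₀ ≤ a₁) :
    B6.Prop27Printed (d + 1) (fun i : Index d L hd hL a₀ a₁ => twoScaleGeo i.toFrame) (fun i => i.qinv) := by
  obtain ⟨δ, hδ, hR⟩ := ineq2148_V1_uniform d L hd hL ha₀ ha₁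
  have hL1 : (1 : ℝ) ≤ L := by exact_mod_cast hL.2.le
  have hL0 : (0 : ℝ) < L := by linarith
  have hγ1 : 0 < gamma1 (d + 1) := Beta.Ineq167OperatorUpper.gamma1_pos (d + 1)
  have ha₁0 : 0 < a₁ := ha₀.trans_le ha₁
  -- the (2.148) prefactor at `κ = 1`
  set A : ℝ := 2 / ((a₁ * 1 * (1 + ((L : ℝ) ^ (d + 1))⁻¹) + 1 * (gamma1 (d + 1) * (8 * (d + 1 : ℕ))))⁻¹ *
    (2 + 4 * (L : ℝ) ^ 2 + (L : ℝ) ^ (d + 1 + 2))⁻¹) with hA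
  have hA0 : 0 < A := by positivity
  refine ⟨1, 2 * δ, A * ((L : ℝ) ^ (2 : ℝ) * (L : ℝ) ^ (((d + 1 : ℕ) : ℝ))), one_pos, by positivity, by positivity, fun i _ _ b b' => ?_⟩
  have hρ := torusDist_isPseudoDist i.M
  -- (2.148) for the member, at `κ = 1`
  have hκ := i.kappa_c₁
  have h := hR i.m i.K i.c₁ i.c₁_ne_zero i.j i.hj i.Λ' i.w (fun k => by rw [hκ, mul_one]; exact i.hw0 k)
    (fun k => by rw [hκ, mul_one]; exact i.hw1 k) b b'
  rw [hκ] at h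
  have h' : |(i.qinv).ker b b'| ≤ A * Real.exp (-(δ * (twoScaleGeo i.toFrame).dist b b')) := h
  -- the length factors and the rate `½·(2δ) = δ`
  have h22 : 2 * δ / 2 = δ := by ring
  rw [h22]
  have hLb : 1 ≤ (L : ℝ) ^ (2 : ℝ) * (twoScaleGeo i.toFrame).len b ^ (-(2 : ℝ)) :=
    one_le_rpow_mul_len i.toFrame b (by norm_num) le_rfl
  have hLb' : 1 ≤ (L : ℝ) ^ (((d + 1 : ℕ) : ℝ)) * (twoScaleGeo i.toFrame).len b' ^ (-((d + 1 : ℕ) : ℝ)) :=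
    one_le_rpow_mul_len i.toFrame b' (Nat.cast_nonneg (d + 1)) le_rfl
  have hE0 : 0 ≤ Real.exp (-(δ * (twoScaleGeo i.toFrame).dist b b')) := (Real.exp_pos _).le
  calc |(i.qinv).ker b b'| ≤ A * Real.exp (-(δ * (twoScaleGeo i.toFrame).dist b b')) * 1 * 1 := by rw [mul_one, mul_one]; exact h'
    _ ≤ A * Real.exp (-(δ * (twoScaleGeo i.toFrame).dist b b')) *
          ((L : ℝ) ^ (2 : ℝ) * (twoScaleGeo i.toFrame).len b ^ (-(2 : ℝ))) *
          ((L : ℝ) ^ (((d + 1 : ℕ) : ℝ)) * (twoScaleGeo i.toFrame).len b' ^ (-((d + 1 : ℕ) : ℝ))) :=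
        mul_le_mul (mul_le_mul_of_nonneg_left hLb (mul_nonneg hA0.le hE0)) hLb' zero_le_one (by positivity)
    _ = A * ((L : ℝ) ^ (2 : ℝ) * (L : ℝ) ^ (((d + 1 : ℕ) : ℝ))) * (twoScaleGeo i.toFrame).len b ^ (-(2 : ℝ)) *
          (twoScaleGeo i.toFrame).len b' ^ (-((d + 1 : ℕ) : ℝ)) * Real.exp (-(δ * (twoScaleGeo i.toFrame).dist b b')) := by ring

/-- **Non-vacuity**: every member satisfies the hypotheses of `B6.Prop27Printed` with the witness `M₁ = 1` ((2.1)–(2.2) void, `M = 1`), and there is a member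
for every volume, level, region `Λ′` and weight of the printed window. [cite: Balaban1984PropagatorsII, Prop. 2.7 p.249] -/
theorem twoScale27_meets_hypotheses (m K j : ℕ) (hj : j + 1 ≤ m + K) (Λ' : Finset (Site (⟨d + 1, L, m, K, hd, hL⟩ : Params) (j + 1)))
    (w : CIdx j Λ' → ℝ) (hw0 : ∀ i, a₀ ≤ w i) (hw1 : ∀ i, w i ≤ a₁) :
    ∃ i : Index d L hd hL a₀ a₁, i.m = m ∧ i.K = K ∧ i.j = j ∧ HEq i.Λ' Λ' ∧ HEq i.w w ∧
      (twoScaleGeo i.toFrame).Hyp21_22 ∧ (1 : ℝ) ≤ (twoScaleGeo i.toFrame).M :=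
  ⟨⟨⟨m, K, j, hj, Λ'⟩, w, hw0, hw1⟩, rfl, rfl, rfl, HEq.rfl, HEq.rfl, trivial, le_rfl⟩

end Literature.MathematicalPhysics.QuantumFieldTheory.Balaban1983to89.B6Prop27PrintedTwoScaleV1

end
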